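import Summits.Ventures.HSemireg.WedgeHankelRecurrenceGaussChebyshevCAntiFixedPointIdeal

/-!
# Venture HSemireg — **THE DYADIC PRODUCT FORMULAS `S_{2^j − 1} = Π_{i<j} C_{2^i}` AND `C_{2^{j+1}} − 2 = (X² − 4) · (Π_{i<j} C_{2^i})²` IN EVERY COMMUTATIVE RING**, and the integer reading for ANY
# Lucas–Lehmer-type iteration `s_0 = a`, `s_{j+1} = s_j² − 2` over `ℤ`: **`s_j = C_{2^j}(a)`** and **`s_{j+1} − 2 = (a² − 4) · (Π_{i<j} s_i)²`** (so every `s_i`, `i < j`, divides `s_{j+1} − 2`, and the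
# square class of `s_{j+1} − 2` is that of `a² − 4`) — from `S_{2k−1} = C_k S_{k−1}` (N481) and `C_{2k} − 2 = (X² − 4) S_{k−1}²`, `C_{2k} + 2 = C_k²` (N485)

HONEST FRAMING. Part of the Lean index of the computation cell `pub-hsemireg` (seat p10 gen 48, Sunday typer «UNIFORM-IN-n»).  Polynomial ∕ integer algebra only; no variety, no cohomology theory, no
sheaf, no Ext group and no semiregularity map is constructed here; nothing here says that HC / HC_CM / HC_AV holds; no primality test is proved here; no Literature fact (unproved `Prop`) is declared
or used.  Custodian versions as in `WedgeHankelSiegelIdeal` (1/3).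
SOURCES (cited).  D. H. Lehmer, Ann. of Math. 31 (1930) 419–448, §5; P. Ribenboim, *The Little Book of Bigger Primes* (2004), Ch. 2 §V (Lucas–Lehmer residues); R. Lidl, G. L. Mullen, G. Turnwald,
*Dickson Polynomials* (1993), Ch. 2.
PROOF TYPED HERE.  N481 `chebyshevC_mul_S`; N485 `chebyshevC_two_mul_sub_two`, `chebyshevC_two_mul_add_two`; Mathlib `Finset.prod_range_succ`, `Finset.prod_range_zero`, `S_neg_one ∕ S_zero ∕ C_one`,
`Polynomial.eval_prod`.
DEDUP DISCLOSURE (`rg -n 'chebyshevS_two_pow_pred_eq_prod|chebyshevC_two_pow_succ_sub_two|lucasLehmerIter_eq_chebyshevC_eval|lucasLehmerIter_succ_sub_two' Summits Literature HarnessLib`, 2026-09-04):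
`Literature/NumberTheory/LucasSequences/MersenneLucasLehmer.lean` (`V_two_pow_succ`, `s_eq_pow_add_pow` — the `ω`-form of `s_j`, different statements); 0 hits for the 4 names below.

WHAT IS IN THE TREE.  N481, N485; Literature `MersenneLucasLehmer`.
THIS FILE (namespace `Summit.Ventures.HSemireg.Wedge.HankelOuter` continued; CHAINED on N491; 0 definitions):
* §1257 **`chebyshevS_two_pow_pred_eq_prod`**, **`chebyshevC_two_pow_succ_sub_two`**, `lucasLehmerIter_eq_chebyshevC_eval`, **`lucasLehmerIter_succ_sub_two`**.
CAVEATS.  Nothing Ext-side; nothing about primality.  New names only.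
-/

open Module Polynomial
open scoped Matrix Polynomial

namespace Summit.Ventures.HSemireg.Wedge.HankelOuter

/-! ## §1257. Dyadic products -/

/-- **`S_{2^j − 1} = Π_{i<j} C_{2^i}`** in every commutative ring. [Lidl–Mullen–Turnwald Ch. 2; this file, §1257] -/
theorem chebyshevS_two_pow_pred_eq_prod {R : Type*} [CommRing R] (j : ℕ) :
    Polynomial.Chebyshev.S R ((2 ^ j : ℕ) - 1 : ℤ) = ∏ i ∈ Finset.range j, Polynomial.Chebyshev.C R ((2 ^ i : ℕ) : ℤ) := by
  induction j with
  | zero => rw [Finset.prod_range_zero, pow_zero, Nat.cast_one, sub_self, Polynomial.Chebyshev.S_zero]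
  | succ j ih =>
    have h := chebyshevC_mul_S (R := R) ((2 ^ j : ℕ) : ℤ) (((2 ^ j : ℕ) : ℤ) - 1)
    rw [show (((2 ^ j : ℕ) : ℤ) - 1) + ((2 ^ j : ℕ) : ℤ) = ((2 ^ (j + 1) : ℕ) : ℤ) - 1 by push_cast; ring, show (((2 ^ j : ℕ) : ℤ) - 1) - ((2 ^ j : ℕ) : ℤ) = -1 by ring,
      Polynomial.Chebyshev.S_neg_one, add_zero, ih] at h
    rw [← h, Finset.prod_range_succ, mul_comm]

/-- **`C_{2^{j+1}} − 2 = (X² − 4) · (Π_{i<j} C_{2^i})²`** in every commutative ring. [Lehmer 1930 §5; this file, §1257] -/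
theorem chebyshevC_two_pow_succ_sub_two {R : Type*} [CommRing R] (j : ℕ) :
    Polynomial.Chebyshev.C R ((2 ^ (j + 1) : ℕ) : ℤ) - 2 = (Polynomial.X ^ 2 - 4) * (∏ i ∈ Finset.range j, Polynomial.Chebyshev.C R ((2 ^ i : ℕ) : ℤ)) ^ 2 := by
  rw [← chebyshevS_two_pow_pred_eq_prod, show (((2 ^ (j + 1) : ℕ)) : ℤ) = 2 * ((2 ^ j : ℕ) : ℤ) by push_cast; ring, chebyshevC_two_mul_sub_two]

/-- A Lucas–Lehmer-type iteration `s_0 = a`, `s_{j+1} = s_j² − 2` over `ℤ` is `s_j = C_{2^j}(a)`. [Lehmer 1930 §5; this file, §1257] -/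
theorem lucasLehmerIter_eq_chebyshevC_eval {a : ℤ} {s : ℕ → ℤ} (hs0 : s 0 = a) (hs : ∀ j, s (j + 1) = s j ^ 2 - 2) (j : ℕ) :
    s j = (Polynomial.Chebyshev.C ℤ ((2 ^ j : ℕ) : ℤ)).eval a := by
  induction j with
  | zero => rw [hs0, pow_zero, Nat.cast_one, Polynomial.Chebyshev.C_one, eval_X]
  | succ j ih =>
    have h := congrArg (Polynomial.eval a) (chebyshevC_two_mul_add_two (R := ℤ) ((2 ^ j : ℕ) : ℤ))
    rw [eval_add, eval_pow, eval_ofNat, ← ih] at h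
    rw [hs j, show (((2 ^ (j + 1) : ℕ)) : ℤ) = 2 * ((2 ^ j : ℕ) : ℤ) by push_cast; ring]
    linear_combination (-1 : ℤ) * h

/-- **`s_{j+1} − 2 = (a² − 4) · (Π_{i<j} s_i)²`** for every iteration `s_0 = a`, `s_{j+1} = s_j² − 2` over `ℤ`. [Lehmer 1930 §5; Ribenboim Ch. 2 §V; this file, §1257] -/
theorem lucasLehmerIter_succ_sub_two {a : ℤ} {s : ℕ → ℤ} (hs0 : s 0 = a) (hs : ∀ j, s (j + 1) = s j ^ 2 - 2) (j : ℕ) :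
    s (j + 1) - 2 = (a ^ 2 - 4) * (∏ i ∈ Finset.range j, s i) ^ 2 := by
  have h := congrArg (Polynomial.eval a) (chebyshevC_two_pow_succ_sub_two (R := ℤ) j)
  rw [eval_sub, eval_ofNat, eval_mul, eval_pow, eval_sub, eval_pow, eval_X, eval_ofNat, Polynomial.eval_prod] at h
  rw [lucasLehmerIter_eq_chebyshevC_eval hs0 hs (j + 1), h]
  congr 2
  exact Finset.prod_congr rfl fun i _ => (lucasLehmerIter_eq_chebyshevC_eval hs0 hs i).symm

end Summit.Ventures.HSemireg.Wedge.HankelOuter
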